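import Literature.Topology.FourManifolds.MMSWPictureGluingData
import Literature.Topology.FourManifolds.MMSWPictureSurgery
import Literature.Topology.FourManifolds.LinkFramedUniqueness
import Literature.Topology.FourManifolds.KirbyMovesBlowDown
import HarnessLib

/-!
# Proof of `pictureSurgeryPresentation` (Kirby, Lemma I.2.1 / MMSW §3.1)

Topic `Literature/Topology/FourManifolds`.  This file proves the named fact
`Literature.Topology.FourManifolds.pictureSurgeryPresentation` of `MMSWPictureSurgery.lean`
(`pictureSurgeryPresentation_holds`): if a `3`-manifold `Y` is presented as `0`-surgery on the
picture link `U_1 ∪ ⋯ ∪ U_k ∪ P(K)` of a model knot `K ⊆ M_k = ∂X_k`, then `Y` is the union of the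
complement `M_k ∖ K` of the knot in the model boundary and the open solid torus glued in at
`P(K)`, glued along a tube `ν_K` about `K` inside `M_k` whose picture is a `0`-framed tube about
`P(K)`.  Source: R. Kirby, *The Topology of 4-Manifolds*, LNM 1374 (1989), Ch. I §2 (p. 5,
"an unknotted circle with a dot"), Lemma 2.1: zero-surgery on the unlink `U_1 ∪ ⋯ ∪ U_k` gives
`#_k S¹ × S² = ∂(♮_k S¹ × B³)`; Gompf–Stipsicz (1999), §5.4.

## The proof

Kirby's lemma is stated without proof ("obvious from the picture"); the formal proof is the
explicit identification constructed in the files `MMSWPicture*.lean`: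

* `MMSWPictureDottedTubes`: the thin round `0`-framed tubes about the dotted circles;
* `MMSWPictureOuterChart`, `MMSWPictureOuterBand`: the Möbius dilation straightening the outer
  end of `M_k` and the latitude coordinate;
* `MMSWPictureInnerRadial`, `MMSWPictureRadialCollar(B)`, `MMSWPictureCollars`,
  `MMSWPictureCompression`: the radial compression of `M_k` near its core circles onto thin
  tubes (implicit-function straightenings);
* `MMSWPictureModelPieces`, `MMSWPictureModelMap`, `MMSWPictureModelInj`, `MMSWPictureGluing`,
  `MMSWPictureSectionsGeneric`, `MMSWPictureSectionsCore`, `MMSWPictureCover`: the model map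
  `M_k ∖ K → Y`, its injectivity, smoothness, local smooth inverses, openness and the covering;
* `MMSWPictureGluingData`: the gluing data of a surgery presentation with round tubes.

Here: the tubes of the given presentation are replaced by round thin tubes about the dotted
circles and a thin tube about `P(K)` inside the good region of the picture (framed uniqueness of
tubular neighbourhoods, `Link.exists_diffeomorph_eq_of_hasFraming`, transporting the embedding of
the link complement and keeping the solid tori), the gluing data are formed, and the conclusions
are read off.

## References

* R. Kirby, *The Topology of 4-Manifolds*, LNM 1374, Springer (1989), Ch. I §2, Lemma 2.1.
  [Kirby1989]
* R. Gompf, A. Stipsicz, *4-Manifolds and Kirby Calculus* (1999), §5.4.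
-/

open scoped Manifold ContDiff Topology Real ComplexConjugate
open Function Set Metric Filter

noncomputable section

namespace Literature.Topology.FourManifolds

/-- Local notation: `𝔼 n` is the model Euclidean space `EuclideanSpace ℝ (Fin n)`. -/
local notation "𝔼 " n:arg => EuclideanSpace ℝ (Fin n)
/-- Local notation: `𝕊 n` is the unit sphere of `EuclideanSpace ℝ (Fin (n + 1))`. -/
local notation "𝕊 " n:arg => (Metric.sphere (0 : EuclideanSpace ℝ (Fin (n + 1))) 1)

namespace MMSW

open Literature.AlgebraicTopology.Homotopy.HopfFibration (zC wC ofZW zC_ofZW wC_ofZW ofZW_zC_wC)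

variable {k : ℕ} {η : ℝ}

/-! ## Complex coordinates on `ℝ⁴` -/

/-- The complex coordinates `(z, w)` of a point of `ℝ⁴`. [folklore] -/
def zw (x : 𝔼 4) : ℂ × ℂ := (zC x, wC x)

/-- The complex coordinates are injective. [folklore] -/
theorem zw_injective : Injective (zw : 𝔼 4 → ℂ × ℂ) := fun x y h ↦ by
  rw [← ofZW_zC_wC x, ← ofZW_zC_wC y]
  simp only [zw, Prod.mk.injEq] at h
  rw [h.1, h.2]

/-- The complex coordinates of `ofZW`. [folklore] -/
theorem zw_ofZW (p : ℂ × ℂ) : zw (ofZW p.1 p.2) = p := by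
  simp [zw, zC_ofZW, wC_ofZW]

/-- The complex coordinates are smooth. [folklore] -/
theorem contDiff_zw : ContDiff ℝ ∞ (zw : 𝔼 4 → ℂ × ℂ) := contDiff_zC.prodMk contDiff_wC

/-- The inverse of the complex coordinates is smooth. [folklore] -/
theorem contDiff_ofZW : ContDiff ℝ ∞ (fun p : ℂ × ℂ ↦ ofZW p.1 p.2) := by
  rw [contDiff_euclidean]
  intro i
  fin_cases i
  · simp only [ofZW]
    exact Complex.reCLM.contDiff.comp contDiff_fst
  · simp only [ofZW]
    exact Complex.imCLM.contDiff.comp contDiff_fst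
  · simp only [ofZW]
    exact Complex.reCLM.contDiff.comp contDiff_snd
  · simp only [ofZW]
    exact Complex.imCLM.contDiff.comp contDiff_snd

/-! ## The new tube about the model knot -/

section NuK

variable {Kf : (𝕊 1) → 𝕊 3} (ν' : Knot.TubularNbhd Kf)

/-- **The tube `ν_K` about `K` inside `M_k`**: the chart lift of the picture of `ν'`. [folklore] -/
def nuK (k : ℕ) (ν' : Knot.TubularNbhd Kf) (q : (𝕊 1) × (𝔼 2)) : 𝔼 4 :=
  chartLift k (stereoNorthCoords ((ν' q : 𝕊 3) : 𝔼 4))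

variable {ν'} (hν' : range ν' ⊆ Olast k η)
include hν'

/-- The tube points lie in the good region. [folklore] -/
theorem nuK_aux (q : (𝕊 1) × (𝔼 2)) : ν' q ≠ northPole ∧
    stereoNorthCoords ((ν' q : 𝕊 3) : 𝔼 4) ∈ pictureRegion k ∧
    3 * η < ‖wC (nuK k ν' q)‖ ^ 2 := hν' ⟨q, rfl⟩

/-- The picture of `ν_K` is `ν'` (chart form). [folklore] -/
theorem draw_nuK (q : (𝕊 1) × (𝔼 2)) : draw k (nuK k ν' q) = stereoNorthCoords ((ν' q : 𝕊 3) : 𝔼 4) :=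
  draw_chartLift (nuK_aux hν' q).2.1

/-- The picture of `ν_K` is `ν'`. [folklore] -/
theorem stereoNorthInv_draw_nuK (q : (𝕊 1) × (𝔼 2)) : stereoNorthInv (draw k (nuK k ν' q)) = ν' q := by
  rw [draw_nuK hν', stereoNorthInv_stereoNorthCoords (nuK_aux hν' q).1]

/-- `ν_K` takes values in `M_k`. [folklore] -/
theorem nuK_mem (q : (𝕊 1) × (𝔼 2)) : nuK k ν' q ∈ modelBoundary k :=
  chartLift_mem_modelBoundary (nuK_aux hν' q).2.1

/-- `ν_K` misses the cores. [folklore] -/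
theorem wC_nuK_ne (q : (𝕊 1) × (𝔼 2)) : wC (nuK k ν' q) ≠ 0 :=
  wC_chartLift_ne_zero (nuK_aux hν' q).2.1

/-- `ν_K` is smooth. [folklore] -/
theorem contMDiff_nuK : ContMDiff ((𝓡 1).prod 𝓘(ℝ, 𝔼 2)) 𝓘(ℝ, 𝔼 4) ∞ (nuK k ν') := by
  intro q
  obtain ⟨hN, hreg, -⟩ := nuK_aux hν' q
  haveI : Fact (Module.finrank ℝ (𝔼 4) = 3 + 1) := ⟨finrank_euclideanSpace_fin⟩
  have h1 : ContMDiffAt ((𝓡 1).prod 𝓘(ℝ, 𝔼 2)) 𝓘(ℝ, 𝔼 4) ∞ (fun q ↦ ((ν' q : 𝕊 3) : 𝔼 4)) q :=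
    (contMDiff_coe_sphere.comp ν'.contMDiff) q
  have h2 : ContMDiffAt 𝓘(ℝ, 𝔼 4) 𝓘(ℝ, (ℝ × ℝ) × ℝ) ∞ stereoNorthCoords ((ν' q : 𝕊 3) : 𝔼 4) :=
    (contDiffAt_stereoNorthCoords (apply_three_ne_one_of_ne_northPole hN)).contMDiffAt
  have h3 : ContMDiffAt 𝓘(ℝ, (ℝ × ℝ) × ℝ) 𝓘(ℝ, 𝔼 4) ∞ (chartLift k)
      (stereoNorthCoords ((ν' q : 𝕊 3) : 𝔼 4)) := (contDiffAt_chartLift hreg).contMDiffAt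
  exact h3.comp q (h2.comp q h1)

/-- `ν_K` is injective. [folklore] -/
theorem nuK_injective : Injective (nuK k ν') := fun q q' h ↦ ν'.injective (by
  rw [← stereoNorthInv_draw_nuK hν' q, ← stereoNorthInv_draw_nuK hν' q', h])

/-- `ν_K` has injective differential (it has a smooth left inverse). [folklore] -/
theorem mfderiv_nuK_injective (q : (𝕊 1) × (𝔼 2)) :
    Injective (mfderiv ((𝓡 1).prod 𝓘(ℝ, 𝔼 2)) 𝓘(ℝ, 𝔼 4) (nuK k ν') q) := by
  haveI : Nonempty ((𝕊 1) × (𝔼 2)) := ⟨q⟩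
  set Λ : 𝔼 4 → (𝕊 1) × (𝔼 2) := fun x ↦ invFun ν' (stereoNorthInv (draw k x)) with hΛ
  have hleft : Λ ∘ nuK k ν' = id := by
    funext q'
    simp only [hΛ, comp_apply, id_eq, stereoNorthInv_draw_nuK hν']
    exact leftInverse_invFun ν'.injective q'
  have hmd : MDifferentiableAt 𝓘(ℝ, 𝔼 4) ((𝓡 1).prod 𝓘(ℝ, 𝔼 2)) Λ (nuK k ν' q) := by
    have h1 : ContMDiffAt 𝓘(ℝ, 𝔼 4) (𝓡 3) ∞ (fun x ↦ stereoNorthInv (draw k x)) (nuK k ν' q) :=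
      contMDiff_stereoNorthInv.contMDiffAt.comp _ (contDiffAt_draw (wC_nuK_ne hν' q)).contMDiffAt
    have h2 : ContMDiffAt (𝓡 3) ((𝓡 1).prod 𝓘(ℝ, 𝔼 2)) ∞ (invFun ν')
        (stereoNorthInv (draw k (nuK k ν' q))) := by
      rw [stereoNorthInv_draw_nuK hν' q]
      exact (Literature.Geometry.Manifold.contMDiffOn_invFun_range ν'.isSmoothEmbedding_coe).contMDiffAt
        (ν'.isOpenMap.isOpen_range.mem_nhds ⟨q, rfl⟩)
    exact (ContMDiffAt.comp (nuK k ν' q) h2 h1).mdifferentiableAt (by simp)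
  have hmdK : MDifferentiableAt ((𝓡 1).prod 𝓘(ℝ, 𝔼 2)) 𝓘(ℝ, 𝔼 4) (nuK k ν') q :=
    (contMDiff_nuK hν' q).mdifferentiableAt (by simp)
  have hcomp := mfderiv_comp q hmd hmdK
  rw [hleft, mfderiv_id] at hcomp
  have hpt : ∀ v, mfderiv 𝓘(ℝ, 𝔼 4) ((𝓡 1).prod 𝓘(ℝ, 𝔼 2)) Λ (nuK k ν' q)
      (mfderiv ((𝓡 1).prod 𝓘(ℝ, 𝔼 2)) 𝓘(ℝ, 𝔼 4) (nuK k ν') q v) = v := fun v ↦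
    (DFunLike.congr_fun hcomp v).symm
  exact LeftInverse.injective
    (g := mfderiv 𝓘(ℝ, 𝔼 4) ((𝓡 1).prod 𝓘(ℝ, 𝔼 2)) Λ (nuK k ν' q)) hpt

/-- The picture of `ν_K` drawn on the `3`-sphere is `ν'`. [folklore] -/
theorem toSphereThree_draw_nuK (q : (𝕊 1) × (𝔼 2)) :
    toSphereThree (draw k (nuK k ν' q)).1 (draw k (nuK k ν' q)).2 = ν' q := by
  rw [toSphereThree_eq_stereoNorthInv, stereoNorthInv_draw_nuK hν']

/-- **The tube relation**: a point `x ∈ M_k` off the cores and of low potential has virtual point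
`ν' q` iff `x = ν_K q` (`0 < η`). [folklore] -/
theorem virtS_eq_iff_eq_nuK (hη : 0 < η) {x : 𝔼 4} (hx : x ∈ modelBoundary k) (q : (𝕊 1) × (𝔼 2)) :
    (wC x ≠ 0 ∧ planarPot k (zC x) < 1 - 3 * η ∧ virtS k η (zC x, wC x) = ν' q) ↔ x = nuK k ν' q := by
  constructor
  · rintro ⟨hw, hg, hv⟩
    rw [← stereoNorthInv_draw_eq_virtS hη hx (by linarith)] at hv
    have h1 : draw k x = stereoNorthCoords ((ν' q : 𝕊 3) : 𝔼 4) := by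
      rw [← hv, coe_stereoNorthInv, stereoNorthCoords_stereoNorthInvCoe]
    rw [nuK, ← h1, chartLift_draw hx hw]
  · rintro rfl
    obtain ⟨-, hw, hg, hv⟩ := lift_of_mem_Olast hη (hν' ⟨q, rfl⟩)
    exact ⟨hw, hg, hv⟩

omit hν' in
/-- On the zero section `ν_K` is the model knot (when `ν'` is a tube about its picture).
[folklore] -/
theorem nuK_zero {K : (𝕊 1) → 𝔼 4} (hKM : ∀ t, K t ∈ modelBoundary k) (hKw : ∀ t, wC (K t) ≠ 0)
    (hν0 : ∀ u, ν' (u, 0) = stereoNorthInv (draw k (K u))) (u : 𝕊 1) : nuK k ν' (u, 0) = K u := by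
  unfold nuK
  rw [hν0, coe_stereoNorthInv, stereoNorthCoords_stereoNorthInvCoe, chartLift_draw (hKM u) (hKw u)]

end NuK

/-! ## Conclusions read off from gluing data -/

section FromGluing

variable {Y : Type} [TopologicalSpace Y] [ChartedSpace (𝔼 3) Y] (G : Gluing k η Y)
  {K : (𝕊 1) → 𝔼 4} (hKC : G.KC = fun t ↦ zw (K t))
include hKC

/-- Membership of the complex coordinates in `M_k ∖ K`. [folklore] -/
theorem zw_mem_Sset_iff (x : 𝔼 4) : zw x ∈ G.Sset ↔ x ∈ modelBoundary k ∧ x ∉ range K := by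
  show (zw x ∈ Mset k ∧ zw x ∉ range G.KC) ↔ _
  rw [hKC, zw, mem_Mset_iff]
  refine and_congr Iff.rfl (not_congr ⟨?_, ?_⟩)
  · rintro ⟨t, ht⟩; exact ⟨t, zw_injective ht⟩
  · rintro ⟨t, rfl⟩; exact ⟨t, rfl⟩

/-- `M_k ∖ K` in complex coordinates. [folklore] -/
theorem image_zw_eq_Sset : zw '' {x : 𝔼 4 | x ∈ modelBoundary k ∧ x ∉ range K} = G.Sset := by
  ext p
  constructor
  · rintro ⟨x, hx, rfl⟩; exact (zw_mem_Sset_iff G hKC x).2 hx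
  · intro hp
    refine ⟨ofZW p.1 p.2, (zw_mem_Sset_iff G hKC _).1 (by rwa [zw_ofZW]), zw_ofZW p⟩

/-- The image of `M_k ∖ K` under the model map. [folklore] -/
theorem image_map_zw : (fun x ↦ G.map (zw x)) '' {x : 𝔼 4 | x ∈ modelBoundary k ∧ x ∉ range K} =
    G.map '' G.Sset := by
  rw [← image_zw_eq_Sset G hKC, image_image]

omit hKC in
/-- The domain of smoothness is open. [folklore] -/
theorem isOpen_preimage_goodSet : IsOpen (zw ⁻¹' goodSet k η G.LC) :=
  (isOpen_goodSet G.isOpen_LC).preimage contDiff_zw.continuous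

/-- `M_k ∖ K` lies in the domain of smoothness. [folklore] -/
theorem mem_preimage_goodSet {x : 𝔼 4} (hx : x ∈ modelBoundary k) (hxK : x ∉ range K) :
    x ∈ zw ⁻¹' goodSet k η G.LC :=
  G.Sset_subset_goodSet ((zw_mem_Sset_iff G hKC x).2 ⟨hx, hxK⟩)

omit hKC in
/-- The model map in real coordinates is smooth on the domain of smoothness. [folklore] -/
theorem contMDiffOn_map_zw : ContMDiffOn 𝓘(ℝ, 𝔼 4) (𝓡 3) ∞ (fun x ↦ G.map (zw x)) (zw ⁻¹' goodSet k η G.LC) :=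
  G.contMDiffOn.comp contDiff_zw.contMDiff.contMDiffOn fun _ hx ↦ hx

/-- The image of `M_k ∖ K` is open. [folklore] -/
theorem isOpen_image_map_zw : IsOpen ((fun x ↦ G.map (zw x)) '' {x : 𝔼 4 | x ∈ modelBoundary k ∧ x ∉ range K}) := by
  rw [image_map_zw G hKC]; exact G.isOpen_image

/-- The inverse in real coordinates is smooth on the image. [folklore] -/
theorem contMDiffOn_ofZW_inv : ContMDiffOn (𝓡 3) 𝓘(ℝ, 𝔼 4) ∞ (fun y ↦ ofZW (G.inv y).1 (G.inv y).2)
    ((fun x ↦ G.map (zw x)) '' {x : 𝔼 4 | x ∈ modelBoundary k ∧ x ∉ range K}) := by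
  rw [image_map_zw G hKC]
  exact contDiff_ofZW.contMDiff.comp_contMDiffOn G.contMDiffOn_inv

/-- The inverse in real coordinates is a left inverse. [folklore] -/
theorem ofZW_inv_map {x : 𝔼 4} (hx : x ∈ modelBoundary k) (hxK : x ∉ range K) :
    ofZW (G.inv (G.map (zw x))).1 (G.inv (G.map (zw x))).2 = x := by
  rw [G.inv_map ((zw_mem_Sset_iff G hKC x).2 ⟨hx, hxK⟩)]
  exact ofZW_zC_wC x

/-- **The covering.** [folklore] -/
theorem image_union_range (jBl : solidTorus → Y) (hJB : ∀ b : solidTorus, G.JB (Fin.last k) b = jBl b) :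
    (fun x ↦ G.map (zw x)) '' {x : 𝔼 4 | x ∈ modelBoundary k ∧ x ∉ range K} ∪ range jBl = univ := by
  rw [image_map_zw G hKC, eq_univ_iff_forall]
  intro y
  rcases G.cover' y with h | ⟨b, hb, rfl⟩
  · exact Or.inl h
  · exact Or.inr ⟨⟨b, (mem_solidTorus_iff b).2 hb⟩, (hJB _).symm⟩

/-- **The glue relation.** [folklore] -/
theorem map_zw_eq_iff (hη : 0 < η) {Kf : (𝕊 1) → 𝕊 3} {ν' : Knot.TubularNbhd Kf}
    (hν' : range ν' ⊆ Olast k η) (hT' : ∀ q, G.T' q = ν' q)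
    (jBl : solidTorus → Y) (hJB : ∀ b : solidTorus, G.JB (Fin.last k) b = jBl b)
    {x : 𝔼 4} (hx : x ∈ modelBoundary k) (hxK : x ∉ range K) (b : solidTorus) :
    G.map (zw x) = jBl b ↔ ∃ (u : 𝕊 1) (t : ℝ), t ∈ Ioo (0 : ℝ) 1 ∧
      (b : (𝔼 2) × (𝕊 1)).1 = t • (u : 𝔼 2) ∧ x = nuK k ν' (u, t • ((b : (𝔼 2) × (𝕊 1)).2 : 𝔼 2)) := by
  rw [← hJB, G.map_eq_JB_last_iff ((zw_mem_Sset_iff G hKC x).2 ⟨hx, hxK⟩) ((mem_solidTorus_iff _).1 b.2)]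
  refine exists_congr fun u ↦ exists_congr fun t ↦ and_congr Iff.rfl (and_congr Iff.rfl ?_)
  rw [hT']
  exact virtS_eq_iff_eq_nuK hν' hη hx _

end FromGluing

/-! ## Choice of `η`, the round tubes -/

/-- **Choice of `η`**: `0 < η ≤ 1/40` with `4η ≤ |w|²` along the (compact) model knot. [folklore] -/
theorem exists_eta {K : (𝕊 1) → 𝔼 4} (hK : Continuous K) (hKw : ∀ t, wC (K t) ≠ 0) :
    ∃ η : ℝ, 0 < η ∧ η ≤ 1 / 40 ∧ ∀ t, 4 * η ≤ ‖wC (K t)‖ ^ 2 := by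
  haveI : Nonempty (𝕊 1) := ⟨baseS⟩
  have hc : Continuous fun t : 𝕊 1 ↦ ‖wC (K t)‖ ^ 2 :=
    ((contDiff_wC (n := ∞)).continuous.comp hK).norm.pow 2
  obtain ⟨t₀, -, ht₀⟩ := isCompact_univ.exists_isMinOn univ_nonempty hc.continuousOn
  have hm : 0 < ‖wC (K t₀)‖ ^ 2 := by have := norm_pos_iff.2 (hKw t₀); positivity
  refine ⟨min (1 / 40) (‖wC (K t₀)‖ ^ 2 / 4), lt_min (by norm_num) (by positivity), min_le_left _ _,
    fun t ↦ ?_⟩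
  have h1 := ht₀ (mem_univ t)
  simp only [mem_setOf_eq] at h1
  have := min_le_right (1 / 40 : ℝ) (‖wC (K t₀)‖ ^ 2 / 4)
  linarith

/-- **The reflection bit of a thin tube.** [folklore] -/
theorem exists_flip (j : Fin k) (Kn : Knot) (hK : ⇑Kn = dottedCircle k j) :
    ∃ b : Bool, ∀ q : (𝕊 1) × (𝔼 2), dottedTube j Kn hK q = dottedTubeFun k j (q.1, flipE b q.2) := by
  rcases dottedTube_apply_or j Kn hK with h | h
  · exact ⟨false, fun q ↦ by rw [h]; rfl⟩
  · exact ⟨true, fun q ↦ by rw [h]; rfl⟩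

/-- The good region misses the thin tubes about the dotted circles. [folklore] -/
theorem not_mem_Olast_of_mem_range_dottedTubeFun (j : Fin k) {a : 𝕊 3}
    (ha : a ∈ range (dottedTubeFun k j)) : a ∉ Olast k η := by
  rintro ⟨hN, hreg, -⟩
  have hX : approxMap k 0 (chartLift k (stereoNorthCoords (a : 𝔼 4))) = a := by
    rw [approxMap_zero, toSphereThree_eq_stereoNorthInv, draw_chartLift hreg,
      stereoNorthInv_stereoNorthCoords hN]
  have ha' : approxMap k 0 (chartLift k (stereoNorthCoords (a : 𝔼 4))) ∈ range (dottedTubeFun k j) := by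
    rw [hX]; exact ha
  exact approxMap_zero_notMem_range_dottedTubeFun j (chartLift_mem_modelBoundary hreg)
    (wC_chartLift_ne_zero hreg) ha'

/-- The picture knot lies in the good region (`0 < η`, `4η ≤ |w|²` on `K`). [folklore] -/
theorem stereoNorthInv_draw_mem_Olast (hη : 0 < η) {K : (𝕊 1) → 𝔼 4} (hKM : ∀ t, K t ∈ modelBoundary k)
    (hKw : ∀ t, wC (K t) ≠ 0) (hKη : ∀ t, 4 * η ≤ ‖wC (K t)‖ ^ 2) (t : 𝕊 1) :
    stereoNorthInv (draw k (K t)) ∈ Olast k η := by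
  refine ⟨stereoNorthInv_ne_northPole _, ?_, ?_⟩
  · rw [coe_stereoNorthInv, stereoNorthCoords_stereoNorthInvCoe]
    exact draw_mem_pictureRegion (hKM t) (hKw t)
  · rw [coe_stereoNorthInv, stereoNorthCoords_stereoNorthInvCoe, chartLift_draw (hKM t) (hKw t)]
    linarith [hKη t]

/-- **The round tubes**: thin round `0`-framed tubes about the dotted circles and a `0`-framed tube
about the picture knot inside the good region, with pairwise disjoint images. [folklore] -/
theorem exists_roundTubes (hη : 0 < η) {K : (𝕊 1) → 𝔼 4} (hKM : ∀ t, K t ∈ modelBoundary k)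
    (hKw : ∀ t, wC (K t) ≠ 0) (hKη : ∀ t, 4 * η ≤ ‖wC (K t)‖ ^ 2) {L : Link (Fin (k + 1))}
    (hLj : ∀ j : Fin k, ⇑(L.component j.castSucc) = dottedCircle k j)
    (hLlast : ∀ t, L.component (Fin.last k) t = stereoNorthInv (draw k (K t))) :
    ∃ (νL : ∀ i, Knot.TubularNbhd (L.component i)) (fl : Fin k → Bool),
      (∀ i, (νL i).HasFraming 0) ∧
      (Pairwise fun i j ↦ Disjoint (range (νL i)) (range (νL j))) ∧
      (∀ (j : Fin k) (q : (𝕊 1) × (𝔼 2)), νL j.castSucc q = dottedTubeFun k j (q.1, flipE (fl j) q.2)) ∧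
      range (νL (Fin.last k)) ⊆ Olast k η := by
  -- the last tube
  have hsub : range (L.component (Fin.last k)) ⊆ Olast k η := by
    rintro _ ⟨t, rfl⟩
    rw [hLlast]
    exact stereoNorthInv_draw_mem_Olast hη hKM hKw hKη t
  obtain ⟨ν₀, hν₀⟩ := (L.component (Fin.last k)).exists_tubularNbhd_range_subset isOpen_Olast hsub
  obtain ⟨ν', hr', hfr'⟩ := ν₀.exists_hasFraming_range_eq 0
  have hν' : range ν' ⊆ Olast k η := hr' ▸ hν₀
  -- the round tubes
  choose fl hfl using fun j : Fin k ↦ exists_flip j (L.component j.castSucc) (hLj j)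
  refine ⟨fun i ↦ Fin.lastCases (motive := fun i ↦ Knot.TubularNbhd (L.component i)) ν'
    (fun j ↦ dottedTube j (L.component j.castSucc) (hLj j)) i, fl, fun i ↦ ?_, ?_, fun j q ↦ ?_, ?_⟩
  · induction i using Fin.lastCases with
    | last => simpa using hfr'
    | cast j => simpa using hasFraming_dottedTube j (L.component j.castSucc) (hLj j)
  · intro i i' hii'
    induction i using Fin.lastCases with
    | last =>
      induction i' using Fin.lastCases with
      | last => exact absurd rfl hii'
      | cast j' =>
        simp only [Fin.lastCases_last, Fin.lastCases_castSucc]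
        refine Set.disjoint_left.2 fun a ha ha' ↦ ?_
        exact not_mem_Olast_of_mem_range_dottedTubeFun j' (range_dottedTube_subset j' _ (hLj j') ha')
          (hν' ha)
    | cast j =>
      induction i' using Fin.lastCases with
      | last =>
        simp only [Fin.lastCases_last, Fin.lastCases_castSucc]
        refine Set.disjoint_left.2 fun a ha ha' ↦ ?_
        exact not_mem_Olast_of_mem_range_dottedTubeFun j (range_dottedTube_subset j _ (hLj j) ha)
          (hν' ha')
      | cast j' =>
        simp only [Fin.lastCases_castSucc]
        have hjj' : j ≠ j' := fun h ↦ hii' (by rw [h])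
        exact (disjoint_range_dottedTubeFun hjj').mono (range_dottedTube_subset j _ (hLj j))
          (range_dottedTube_subset j' _ (hLj j'))
  · simp only [Fin.lastCases_castSucc]
    exact hfl j q
  · simpa using hν'

/-! ## The main theorem -/

/-- **Kirby's Lemma I.2.1 for the MMSW picture** (`pictureSurgeryPresentation`): see the module
docstring. [cite: Kirby1989, Ch. I §2, Lemma 2.1] -/
theorem pictureSurgeryPresentation_holds' : pictureSurgeryPresentation := by
  intro k K hK hKw L hL Y _ _ _ _ _ jA jB hpres
  obtain ⟨hLj, hLlast, hfr⟩ := hL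
  obtain ⟨ν, hνfr, hνdisj, hA, hAo, hB, hcov, hBdisj, hglue⟩ := hpres
  obtain ⟨hKs, -, -, hKM⟩ := hK
  -- `η`
  obtain ⟨η, hη, hη', hKη⟩ := exists_eta hKs.continuous hKw
  -- the components
  have hLj' : ∀ j : Fin k, ⇑(L.component j.castSucc) = dottedCircle k j := fun j ↦
    (hLj j).trans (dottedCircle_eq k j).symm
  have hLlast' : ∀ t, L.component (Fin.last k) t = stereoNorthInv (draw k (K t)) := fun t ↦ by
    rw [hLlast, finiteApprox_zero_apply, toSphereThree_eq_stereoNorthInv]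
  -- the round tubes and the transport
  obtain ⟨νL, fl, hfr0, hdisj0, hνj, hν'⟩ := exists_roundTubes hη hKM hKw hKη hLj' hLlast'
  have hfr0' : ∀ i, (νL i).HasFraming (L.framing i) := fun i ↦ by rw [hfr i]; exact hfr0 i
  obtain ⟨F, hfix, hconj⟩ :=
    L.toLink.exists_diffeomorph_eq_of_hasFraming ν νL hνdisj hdisj0 hνfr hfr0'
  set jA' : L.toLink.complement → Y := jA ∘ Link.complDiffeoSymm F L.toLink hfix with hjA'
  have hA' : Manifold.IsSmoothEmbedding (𝓡 3) (𝓡 3) ∞ jA' := isSmoothEmbedding_comp_diffeomorph hA _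
  have hAo' : IsOpen (range jA') := by rw [hjA', Link.range_comp_complDiffeoSymm]; exact hAo
  have hcov' : range jA' ∪ (⋃ i, range (jB i)) = univ := by
    rw [hjA', Link.range_comp_complDiffeoSymm]; exact hcov
  have hglue' : ∀ i a b, jA' a = jB i b ↔ Link.surgeryRel νL i a b := fun i a b ↦ by
    rw [hjA', comp_apply, hglue i]
    change (ν i).glueRel (F.symm a) b ↔ (νL i).glueRel a b
    constructor
    · rintro ⟨u, t, ht, hb, ha⟩
      refine ⟨u, t, ht, hb, ?_⟩
      have := congrArg F ha
      rwa [Diffeomorph.apply_symm_apply, hconj i u _ (norm_smul_coe_sphere_lt_one ht _)] at this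
    · rintro ⟨u, t, ht, hb, ha⟩
      refine ⟨u, t, ht, hb, ?_⟩
      rw [ha, ← hconj i u _ (norm_smul_coe_sphere_lt_one ht _), Diffeomorph.symm_apply_apply]
  -- the gluing data
  let b₀ : solidTorus := ⟨(0, baseS), by rw [mem_solidTorus_iff, norm_zero]; exact one_pos⟩
  set G : Gluing k η Y := gluingOf νL jA' jB fl hη hη' hKM hKw hKη hLj' hLlast' hνj hν' hA' hAo' hB
    hcov' hBdisj hglue' (jB (Fin.last k) b₀) with hG
  have hKC : G.KC = fun t ↦ zw (K t) := rfl
  have hT' : ∀ q, G.T' q = νL (Fin.last k) q := fun q ↦ rfl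
  have hJB : ∀ b : solidTorus, G.JB (Fin.last k) b = jB (Fin.last k) b := fun b ↦ extB_coe _ b
  have hν0 : ∀ u, νL (Fin.last k) (u, 0) = stereoNorthInv (draw k (K u)) := fun u ↦ by
    rw [(νL (Fin.last k)).coe_apply_zero, hLlast']
  -- the conclusions
  refine ⟨jB (Fin.last k), nuK k (νL (Fin.last k)), fun x ↦ G.map (zw x), zw ⁻¹' goodSet k η G.LC,
    fun y ↦ ofZW (G.inv y).1 (G.inv y).2, νL (Fin.last k), 1, ⟨(hB _).1, (hB _).2,
    contMDiff_nuK hν', nuK_injective hν', mfderiv_nuK_injective hν', nuK_mem hν',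
    nuK_zero hKM hKw hν0, isOpen_preimage_goodSet G, fun x hx hxK ↦ mem_preimage_goodSet G hKC hx hxK,
    contMDiffOn_map_zw G, isOpen_image_map_zw G hKC, contMDiffOn_ofZW_inv G hKC,
    fun x hx hxK ↦ ofZW_inv_map G hKC hx hxK, image_union_range G hKC _ hJB,
    fun x hx hxK b ↦ map_zw_eq_iff G hKC hη hν' hT' _ hJB hx hxK b⟩, fun b _ ↦ rfl,
    wC_nuK_ne hν', hfr0 _, one_pos, fun u w _ ↦ ?_⟩
  rw [one_smul]
  exact toSphereThree_draw_nuK hν' (u, w)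

end MMSW

/-- **Kirby's Lemma I.2.1 for the MMSW picture**: the named fact
`Literature.Topology.FourManifolds.pictureSurgeryPresentation` holds. R. Kirby, *The Topology of
4-Manifolds*, LNM 1374 (1989), Ch. I §2, Lemma 2.1 (p. 5: zero-surgery on the dotted unlink gives
`#_k S¹ × S² = ∂(♮_k S¹ × B³)`); the explicit identification is constructed in the files
`MMSWPicture*.lean`. [cite: Kirby1989, Ch. I §2, Lemma 2.1] -/
theorem pictureSurgeryPresentation_holds : pictureSurgeryPresentation :=
  MMSW.pictureSurgeryPresentation_holds'

end Literature.Topology.FourManifolds
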